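import Summits.QuantumFields.YangMills.Theorems.BalabanUVNodesN08HaarCompatibilityGuardCoreInjective
import Mathlib.MeasureTheory.Measure.Lebesgue.EqHaar
import Mathlib.MeasureTheory.Measure.Haar.InnerProductSpace

/-!
# BalabanUVNodes ∕ N08 — quaternion toolkit for the CHART CONJUGATE of the printed core map: the series logarithm of a unit quaternion is an angle
# `< π∕3`, the left-trivialised log differential on the whole log ball, LOWER singular values of `N` and `D exp`, tangency, the QUATERNION TANGENT
# FLOOR of the exp-mean-log fibre map, and the volume lemma «norm floor ⇒ determinant floor»

WIDTH SEAT `pub-ymgap-dag-n08-w3` g5, `W-SEAT-START-LIST.md` §0 (iii); item-3 lineage part 27A = the toolkit of part 27B `…GuardCoreChart` (the chart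
conjugate `ψc` of the core map and (H_K-core) at `N = 2` via part 25 p621260 `core_law_le_of_one_window`), 2026-08-28.  DAG node N08 = [Balaban1985UV3]
Thm 1 p. 257 + Thm 2 p. 272; [Balaban1987RG1] (0.4) p. 253; key item K1⁷ `StabilityBAtRecordR13SepCoPH` (stmt-QuantumFields-20542, `aside`),
`--supports … --as helper`.  COUNT-NEUTRAL.

WHAT THIS FILE PROVES (theorems only, 0 def; [folklore] calculus on `ℍ` over pub-balaban's quaternion model `T4QuatExpLog` ∕ `T4EMLFibreAC` — `qlog`, `N`,
`par`∕`perp`, `G`, `imBall`, `Yf`, `kf`, `kD`, `G_sum_le`, `inner_N_self_eq`, `fderiv_exp_apply_N` BY IMPORT — and parts 26A∕26B of this lineage):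
 §1 `norm_radial_sub_one_le` (the radial projection of the chord `[1, u]` stays in the log ball) · ★ `norm_qlog_lt_pi_div_three` (**unit `u`, `‖u − 1‖ < 1`
    ⇒ `‖qlog u‖ < π∕3`** — intermediate value theorem along that projection against the chord identity `‖p − 1‖ = 2|sin(‖qlog p‖∕2)|` of part 26A) ·
    `norm_sub_one_eq_two_mul_sin_of_lt_one` · ★ `fderiv_qlog_apply_mul_of_lt_one` (**`D qlog(u)(u x) = N_{qlog u} x` on the WHOLE log ball** — pub-balaban's
    `fderiv_qlog_apply_mul` asked `‖u − 1‖ < 1∕2` only to put `‖qlog u‖` below `π`).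
 §2 `N_re` · ★ `norm_le_norm_N` (`‖x‖ ≤ ‖N_w x‖`) · ★ `abs_sinc_mul_norm_le_norm_fderiv_exp` (`|sinc‖w‖|·‖h‖ ≤ ‖D exp(w) h‖`, imaginary `w, h`) ·
    ★ `re_exp_neg_mul_fderiv_exp` (TANGENCY: `e^{−w}·D exp(w) h` is imaginary).
 §3 `exp_neg_mul_exp` ∕ `exp_mul_exp_neg` · ★ `kD_apply_mul` (**`k′(w)(w x) = D exp(Y)(N_Y x̃ − Σᵢcᵢ N_{Zᵢ} x̃)·w`**, `x̃ = w x w̄` — the computation inside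
    pub-balaban's `kD_tangent_injective`, isolated) · ★★★ `exists_kD_mul_eq`: **THE QUATERNION TANGENT FLOOR WITH THE TANGENT FORM OF THE IMAGE** — at a unit
    `w` in the guard `‖aᵢw̄ − 1‖ < 1∕2` (`cᵢ ≥ 0`, `Σcᵢ ≤ 1`), every `k′(w)(w x)` (`x` imaginary) is `k(w)·y` with `y` imaginary and
    `(1 − Σcᵢ)·sinc‖Y(w)‖·‖x‖ ≤ ‖y‖` (Jensen step `G_sum_le` + Cauchy–Schwarz + §2; part 14's bound in quaternion dress — weaker than n08-w6's sharp pinch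
    p617624 by the `sinc` factor, which is immaterial for part 27B).
 §4 ★ `pow_le_abs_det_of_norm_le` (**`κ‖x‖ ≤ ‖f x‖ ∀x`, `κ > 0` ⇒ `κⁿ ≤ |det f|`** on `EuclideanSpace ℝ n`: `f(B(0,1)) ⊇ B(0,κ)` and Lebesgue measure scales by
    `|det f|` — Mathlib `addHaar_image_continuousLinearMap`, `addHaar_ball_of_pos`).
HONEST FRAMING: toolkit only; (H_K) NOT discharged here; E6′ NOT decided; count-neutral; N08 NOT discharged; counts unmoved (typed 28∕28 · discharged 5∕27);
R4 closes the CONDITIONAL rung `BalabanLadder.UV` only; the Yang–Mills mass gap (Clay) is NOT proved; nothing continuum ∕ OS.  0 `sorry`, standard axioms. -/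

noncomputable section

open NormedSpace Set Metric Function Filter MeasureTheory
open scoped RealInnerProductSpace Topology Quaternion

namespace Summit.QuantumFields.YangMills.BalabanUVNodes.N08HaarCompatibilityGuardChartLift

open Literature.MathematicalPhysics.QuantumFieldTheory.Balaban1983to89
open Literature.MathematicalPhysics.QuantumFieldTheory.Balaban1983to89.T4QuatExpLog
open Literature.MathematicalPhysics.QuantumFieldTheory.Balaban1983to89.T4EMLFibreAC
open Summit.QuantumFields.YangMills.BalabanUVNodes.N08HaarCompatibilityGuardGeodesics

/-! ## §1 The series logarithm of a unit quaternion is an angle `< π∕3`; the left-trivialised log differential on the whole log ball -/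

section Log
/-- Radial projection of the chord from `1` to a unit `u` with `‖u − 1‖ < 1` stays in the log ball: for `s ∈ [0,1]` and `c = 1 + s(u − 1)`,
`c ≠ 0` and `‖c∕‖c‖ − 1‖ ≤ ‖u − 1‖`. [folklore] -/
theorem norm_radial_sub_one_le {u : ℍ} (hu1 : ‖u‖ = 1) (hu : ‖u - 1‖ < 1) {s : ℝ} (hs0 : 0 ≤ s) (hs1 : s ≤ 1) :
    (1 : ℍ) + s • (u - 1) ≠ 0 ∧ ‖‖(1 : ℍ) + s • (u - 1)‖⁻¹ • ((1 : ℍ) + s • (u - 1)) - 1‖ ≤ ‖u - 1‖ := by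
  set c : ℍ := 1 + s • (u - 1) with hc_def
  have hc1 : ‖c - 1‖ = s * ‖u - 1‖ := by rw [hc_def, add_sub_cancel_left, norm_smul, Real.norm_of_nonneg hs0]
  have hc1' : ‖c - 1‖ < 1 := by rw [hc1]; nlinarith [norm_nonneg (u - 1)]
  have hcpos : 0 < ‖c‖ := by
    have : 1 - ‖c - 1‖ ≤ ‖c‖ := by
      have := norm_sub_norm_le (1 : ℍ) c
      rw [norm_one, norm_sub_rev] at this; linarith
    linarith
  have hc0 : c ≠ 0 := norm_pos_iff.1 hcpos
  refine ⟨hc0, ?_⟩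
  have hcle : ‖c‖ ≤ 1 := by
    have e : c = (1 - s) • (1 : ℍ) + s • u := by rw [hc_def, smul_sub, sub_smul, one_smul]; abel
    rw [e]
    calc ‖(1 - s) • (1 : ℍ) + s • u‖ ≤ ‖(1 - s) • (1 : ℍ)‖ + ‖s • u‖ := norm_add_le _ _
      _ = (1 - s) + s := by rw [norm_smul, norm_smul, norm_one, hu1, Real.norm_of_nonneg hs0, Real.norm_of_nonneg (by linarith)]; ring
      _ = 1 := by ring
  have hure : u.re = 1 - ‖u - 1‖ ^ 2 / 2 := by
    have h := norm_sub_sq_real u 1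
    rw [hu1, norm_one, Quaternion.inner_def, star_one, mul_one] at h
    linarith
  have hcre : c.re = 1 - s * (‖u - 1‖ ^ 2 / 2) := by
    simp only [hc_def, Quaternion.re_add, Quaternion.re_one, Quaternion.re_smul, Quaternion.re_sub, hure, smul_eq_mul]; ring
  have hcre_pos : 0 ≤ c.re := by
    rw [hcre]
    have : ‖u - 1‖ ^ 2 < 1 := by nlinarith [norm_nonneg (u - 1)]
    nlinarith
  set p : ℍ := ‖c‖⁻¹ • c with hp_def
  have hp1 : ‖p‖ = 1 := by rw [hp_def, norm_smul, norm_inv, norm_norm, inv_mul_cancel₀ hcpos.ne']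
  have hpre : c.re ≤ p.re := by
    rw [hp_def, Quaternion.re_smul, smul_eq_mul]
    have : c.re * ‖c‖ ≤ c.re := by nlinarith
    calc c.re = c.re * ‖c‖ * ‖c‖⁻¹ := by field_simp
      _ ≤ c.re * ‖c‖⁻¹ := by
          rw [mul_comm (c.re) ‖c‖⁻¹]
          exact mul_le_mul_of_nonneg_right this (inv_nonneg.2 hcpos.le) |>.trans_eq (by ring)
      _ = ‖c‖⁻¹ * c.re := mul_comm _ _
  have hsq : ‖p - 1‖ ^ 2 ≤ ‖u - 1‖ ^ 2 := by
    have h1 : ‖p - 1‖ ^ 2 = 2 - 2 * p.re := by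
      rw [norm_sub_sq_real, hp1, norm_one, Quaternion.inner_def, star_one, mul_one]; ring
    rw [h1]
    have : u.re ≤ c.re := by rw [hcre, hure]; nlinarith [sq_nonneg ‖u - 1‖]
    nlinarith
  exact (pow_le_pow_iff_left₀ (norm_nonneg _) (norm_nonneg _) two_ne_zero).1 hsq

/-- ★ **THE SERIES LOGARITHM OF A UNIT QUATERNION IS AN ANGLE `< π∕3`**: for unit `u` with `‖u − 1‖ < 1`, `‖qlog u‖ < π∕3`.  Along the radial
projection `p_s` of the chord from `1` to `u` the function `s ↦ ‖qlog p_s‖` is continuous, vanishes at `s = 0`, and can never equal `π∕3`: there the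
chord identity `‖p − 1‖ = 2|sin(‖qlog p‖∕2)|` (part 26A) would give `‖p_s − 1‖ = 1`, while `‖p_s − 1‖ ≤ ‖u − 1‖ < 1`; intermediate value theorem. [folklore] -/
theorem norm_qlog_lt_pi_div_three {u : ℍ} (hu1 : ‖u‖ = 1) (hu : ‖u - 1‖ < 1) : ‖qlog u‖ < Real.pi / 3 := by
  set c : ℝ → ℍ := fun s => 1 + s • (u - 1) with hc_def
  set p : ℝ → ℍ := fun s => ‖c s‖⁻¹ • c s with hp_def
  set f : ℝ → ℝ := fun s => ‖qlog (p s)‖ with hf_def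
  have hrad : ∀ s ∈ Icc (0 : ℝ) 1, c s ≠ 0 ∧ ‖p s - 1‖ ≤ ‖u - 1‖ := fun s hs => norm_radial_sub_one_le hu1 hu hs.1 hs.2
  have hp1 : ∀ s ∈ Icc (0 : ℝ) 1, ‖p s‖ = 1 := fun s hs => by
    have h0 := (hrad s hs).1
    simp only [hp_def]
    rw [norm_smul, norm_inv, norm_norm, inv_mul_cancel₀ (norm_ne_zero_iff.2 h0)]
  have hcont : ContinuousOn f (Icc 0 1) := by
    intro s hs
    have hc0 : c s ≠ 0 := (hrad s hs).1
    have hcc : Continuous c := by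
      simp only [hc_def]; exact continuous_const.add (continuous_id.smul continuous_const)
    have hpc : ContinuousAt p s := by
      simp only [hp_def]
      exact ((hcc.norm.continuousAt).inv₀ (norm_ne_zero_iff.2 hc0)).smul hcc.continuousAt
    have hq : ContinuousAt qlog (p s) := (contDiffAt_qlog (n := 0) ((hrad s hs).2.trans_lt hu)).continuousAt
    exact ((hq.comp hpc).norm).continuousWithinAt
  have hf0 : f 0 = 0 := by
    simp only [hf_def, hp_def, hc_def, zero_smul, add_zero, norm_one, inv_one, one_smul, qlog_one, norm_zero]
  have hf1 : f 1 = ‖qlog u‖ := by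
    simp only [hf_def, hp_def, hc_def, one_smul, add_sub_cancel, hu1, inv_one]
  by_contra hge
  have hge : Real.pi / 3 ≤ ‖qlog u‖ := not_lt.1 hge
  obtain ⟨s, hs, hfs⟩ : ∃ s ∈ Icc (0 : ℝ) 1, f s = Real.pi / 3 := by
    have hmem : Real.pi / 3 ∈ Icc (f 0) (f 1) := ⟨by rw [hf0]; positivity, by rwa [hf1]⟩
    exact intermediate_value_Icc zero_le_one hcont hmem
  have hX : (qlog (p s)).re = 0 := qlog_re_of_norm_eq_one (hp1 s hs) ((hrad s hs).2.trans_lt hu)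
  have hch := norm_exp_sub_one_eq hX
  rw [exp_qlog ((hrad s hs).2.trans_lt hu)] at hch
  have hfs' : ‖qlog (p s)‖ = Real.pi / 3 := hfs
  rw [hfs', show Real.pi / 3 / 2 = Real.pi / 6 by ring, Real.sin_pi_div_six, abs_of_pos (by norm_num : (0 : ℝ) < 1 / 2)] at hch
  have := (hrad s hs).2
  linarith

/-- On the whole log ball: for unit `W` with `‖W − 1‖ < 1`, `‖W − 1‖ = 2 sin(‖qlog W‖∕2)` (the sine is of an angle in `[0, π∕6)`). [folklore] -/
theorem norm_sub_one_eq_two_mul_sin_of_lt_one {W : ℍ} (hW1 : ‖W‖ = 1) (hW : ‖W - 1‖ < 1) :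
    ‖W - 1‖ = 2 * Real.sin (‖qlog W‖ / 2) := by
  have h := norm_exp_sub_one_eq (qlog_re_of_norm_eq_one hW1 hW)
  rw [exp_qlog hW] at h
  rw [h, abs_of_nonneg]
  have := norm_qlog_lt_pi_div_three hW1 hW
  exact Real.sin_nonneg_of_nonneg_of_le_pi (by positivity) (by linarith [Real.pi_gt_three])

/-- **THE LEFT-TRIVIALISED LOG DIFFERENTIAL ON THE WHOLE LOG BALL**: `D qlog(u)(u·x) = N_{qlog u} x` for a unit `u` with `‖u − 1‖ < 1` and imaginary `x`
(pub-balaban's `fderiv_qlog_apply_mul` asked `‖u − 1‖ < 1∕2` only to place `‖qlog u‖` below `π`; §1 gives `< π∕3` on the whole ball). [folklore] -/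
theorem fderiv_qlog_apply_mul_of_lt_one {u x : ℍ} (hu1 : ‖u‖ = 1) (hu : ‖u - 1‖ < 1) (hx : x.re = 0) :
    fderiv ℝ qlog u (u * x) = N (qlog u) x := by
  have hw : (qlog u).re = 0 := qlog_re_of_norm_eq_one hu1 hu
  have hwπ : ‖qlog u‖ < Real.pi := (norm_qlog_lt_pi_div_three hu1 hu).trans (by linarith [Real.pi_gt_three])
  have h := fderiv_qlog_apply_fderiv_exp hu (N (qlog u) x)
  rwa [fderiv_exp_apply_N hw hwπ hx, exp_qlog hu] at h
end Log

/-! ## §2 Lower singular values of `N` and `D exp`; tangency -/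

section Lower
/-- `e^{−w} e^{w} = 1` in `ℍ` (Mathlib's `exp_add_of_commute` through the `ℚ`-algebra structure restricted from `ℝ`). [folklore] -/
theorem exp_neg_mul_exp (w : ℍ) : exp (-w) * exp w = 1 := by
  letI : NormedAlgebra ℚ ℍ := NormedAlgebra.restrictScalars ℚ ℝ ℍ
  rw [← NormedSpace.exp_add_of_commute (Commute.refl w).neg_left, neg_add_cancel, NormedSpace.exp_zero]
/-- `e^{w} e^{−w} = 1` in `ℍ`. [folklore] -/
theorem exp_mul_exp_neg (w : ℍ) : exp w * exp (-w) = 1 := by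
  simpa using exp_neg_mul_exp (-w)

/-- `N_w x` is imaginary for imaginary `w, x`. [folklore] -/
theorem N_re {w x : ℍ} (hw : w.re = 0) (hx : x.re = 0) : (N w x).re = 0 := by
  have hp : (perp w x).re = 0 := perp_re hw hx
  have hwp : (w * perp w x).re = 0 := by
    have h := inner_perp w x
    rw [Quaternion.inner_def, Quaternion.star_eq_neg.2 hp, mul_neg, Quaternion.re_neg, neg_eq_zero] at h
    exact h
  rw [N, Quaternion.re_add, Quaternion.re_add, Quaternion.re_smul, par_re hw, hp, hwp, smul_zero, zero_add, add_zero]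

/-- **`N` does not shrink**: `‖x‖ ≤ ‖N_w x‖` for imaginary `w, x`, `‖w‖ < π` (`‖N_w x‖² = ‖x_∥‖² + (θ∕sin θ)²‖x_⊥‖²` and `sin θ ≤ θ`). [folklore] -/
theorem norm_le_norm_N {w x : ℍ} (hw : w.re = 0) (hx : x.re = 0) (hwπ : ‖w‖ < Real.pi) : ‖x‖ ≤ ‖N w x‖ := by
  rcases eq_or_ne w 0 with rfl | hw0
  · simp
  have hθ : 0 < ‖w‖ := norm_pos_iff.2 hw0
  have hsin : 0 < Real.sin ‖w‖ := Real.sin_pos_of_pos_of_lt_pi hθ hwπ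
  set θ := ‖w‖ with hθ_def
  set p := perp w x with hp_def
  set q : ℍ := (1 - ψ θ) • p + w * p with hq_def
  have hp_re : p.re = 0 := perp_re hw hx
  have hN : N w x = par w x + q := by rw [N, hq_def, ← hθ_def, add_assoc]
  have h1ψ : 1 - ψ θ = θ * Real.cos θ / Real.sin θ := by rw [ψ_of_ne_zero hθ.ne']; ring
  have hq : ‖q‖ ^ 2 = (θ / Real.sin θ) ^ 2 * ‖p‖ ^ 2 := by
    rw [hq_def, norm_add_sq_real, real_inner_smul_left, inner_self_mul_left hw, mul_zero, mul_zero, add_zero, norm_smul, norm_mul,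
      ← hθ_def, mul_pow, mul_pow, Real.norm_eq_abs, sq_abs, h1ψ]
    field_simp
    have := Real.sin_sq_add_cos_sq θ
    ring_nf
    nlinarith [this]
  have hwp : ⟪w, p⟫ = 0 := by rw [hp_def]; exact inner_perp w x
  have hparq : ⟪par w x, q⟫ = 0 := by
    rw [par, real_inner_smul_left, hq_def, inner_add_right, inner_smul_right, hwp, mul_zero, zero_add,
      inner_left_mul_self hp_re, mul_zero]
  have hparp : ⟪par w x, p⟫ = 0 := by rw [par, real_inner_smul_left, hwp, mul_zero]
  have hNsq : ‖N w x‖ ^ 2 = ‖par w x‖ ^ 2 + (θ / Real.sin θ) ^ 2 * ‖p‖ ^ 2 := by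
    rw [hN, norm_add_sq_real, hparq, hq]; ring
  have hxsq : ‖x‖ ^ 2 = ‖par w x‖ ^ 2 + ‖p‖ ^ 2 := by
    conv_lhs => rw [← par_add_perp w x]
    rw [norm_add_sq_real, ← hp_def, hparp]; ring
  have hratio : 1 ≤ (θ / Real.sin θ) ^ 2 := by
    have h1 : 1 ≤ θ / Real.sin θ := by rw [le_div_iff₀ hsin, one_mul]; exact Real.sin_le hθ.le
    nlinarith
  have hkey : ‖x‖ ^ 2 ≤ ‖N w x‖ ^ 2 := by
    rw [hNsq, hxsq]
    nlinarith [sq_nonneg ‖p‖]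
  exact (pow_le_pow_iff_left₀ (norm_nonneg _) (norm_nonneg _) two_ne_zero).1 hkey

/-- **The lower singular value of `D exp` at an imaginary point**: `|sinc‖w‖|·‖h‖ ≤ ‖D exp(w) h‖` for imaginary `w, h`
(`‖D exp(w) h‖² = ‖h_∥‖² + sinc²‖w‖·‖h_⊥‖²`). [folklore] -/
theorem abs_sinc_mul_norm_le_norm_fderiv_exp {w h : ℍ} (hw : w.re = 0) (hh : h.re = 0) :
    |Real.sinc ‖w‖| * ‖h‖ ≤ ‖fderiv ℝ exp w h‖ := by
  set p := perp w h with hp_def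
  set q := par w h with hq_def
  have hp_re : p.re = 0 := perp_re hw hh
  have hqp : h = q + p := (par_add_perp w h).symm
  have hcomm : Commute w q := by rw [hq_def, par]; exact (Commute.refl w).smul_right _
  have hDq : fderiv ℝ exp w q = q * exp w := fderiv_exp_apply_of_commute hcomm
  have hDp : fderiv ℝ exp w p = Real.sinc ‖w‖ • p := fderiv_exp_apply_of_inner_eq_zero hw hp_re (by rw [hp_def]; exact inner_perp w h)
  have hD : fderiv ℝ exp w h = q * exp w + Real.sinc ‖w‖ • p := by rw [hqp, map_add, hDq, hDp]
  have hcross : ⟪q * exp w, p⟫ = 0 := by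
    have hwp : ⟪w, p⟫ = 0 := by rw [hp_def]; exact inner_perp w h
    have hww : ⟪w * w, p⟫ = 0 := by
      have e : w * w = -((Quaternion.normSq w : ℝ) : ℍ) := by rw [← sq]; exact Quaternion.sq_eq_neg_normSq.2 hw
      rw [e, inner_neg_left, Quaternion.inner_def, Quaternion.coe_mul_eq_smul, Quaternion.re_smul, Quaternion.re_star, hp_re, smul_zero, neg_zero]
    rw [hq_def, par, Quaternion.exp_of_re_eq_zero w hw, smul_mul_assoc, mul_add, Quaternion.mul_coe_eq_smul, mul_smul_comm,
      real_inner_smul_left, inner_add_left, real_inner_smul_left, real_inner_smul_left, hwp, hww, mul_zero, mul_zero, add_zero,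
      mul_zero]
  have hqp0 : ⟪q, p⟫ = 0 := by
    rw [hq_def, par, real_inner_smul_left]
    have hwp : ⟪w, p⟫ = 0 := by rw [hp_def]; exact inner_perp w h
    rw [hwp, mul_zero]
  have hsq : (|Real.sinc ‖w‖| * ‖h‖) ^ 2 ≤ ‖fderiv ℝ exp w h‖ ^ 2 := by
    rw [hD, norm_add_sq_real, inner_smul_right, hcross, mul_zero, mul_zero, add_zero, norm_mul, norm_exp_of_re_eq_zero hw, mul_one,
      norm_smul, mul_pow, mul_pow, Real.norm_eq_abs, sq_abs, hqp, norm_add_sq_real, hqp0, mul_zero, add_zero]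
    have hs : Real.sinc ‖w‖ ^ 2 ≤ 1 := by
      have := Real.abs_sinc_le_one ‖w‖
      rw [← sq_abs]; exact pow_le_one₀ (abs_nonneg _) this
    nlinarith [sq_nonneg ‖q‖, sq_nonneg (Real.sinc ‖w‖)]
  exact (pow_le_pow_iff_left₀ (by positivity) (norm_nonneg _) two_ne_zero).1 hsq

/-- **TANGENCY**: `e^{−w}·D exp(w) h` is imaginary for imaginary `w, h` (the image of `D exp(w)` is the tangent space `e^w·Im ℍ`). [folklore] -/
theorem re_exp_neg_mul_fderiv_exp {w h : ℍ} (hw : w.re = 0) (hh : h.re = 0) : (exp (-w) * fderiv ℝ exp w h).re = 0 := by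
  set p := perp w h with hp_def
  set q := par w h with hq_def
  have hp_re : p.re = 0 := perp_re hw hh
  have hq_re : q.re = 0 := by rw [hq_def]; exact par_re hw h
  have hqp : h = q + p := (par_add_perp w h).symm
  have hcomm : Commute w q := by rw [hq_def, par]; exact (Commute.refl w).smul_right _
  have hDq : fderiv ℝ exp w q = q * exp w := fderiv_exp_apply_of_commute hcomm
  have hDp : fderiv ℝ exp w p = Real.sinc ‖w‖ • p := fderiv_exp_apply_of_inner_eq_zero hw hp_re (by rw [hp_def]; exact inner_perp w h)
  have hee : exp (-w) * exp w = (1 : ℍ) := exp_neg_mul_exp w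
  have hconj : exp (-w) * (q * exp w) = q := by
    have hc : Commute (-w) q := hcomm.neg_left
    rw [← mul_assoc, (hc.exp_left).eq, mul_assoc, hee, mul_one]
  have hwp : ⟪w, p⟫ = 0 := by rw [hp_def]; exact inner_perp w h
  have hrep : (exp (-w) * p).re = 0 := by
    have hnw : (-w).re = 0 := by rw [Quaternion.re_neg, hw, neg_zero]
    rw [Quaternion.exp_of_re_eq_zero _ hnw, add_mul, Quaternion.re_add, Quaternion.coe_mul_eq_smul, Quaternion.re_smul, hp_re, smul_zero,
      zero_add, smul_mul_assoc, Quaternion.re_smul, neg_mul, Quaternion.re_neg]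
    have : (w * p).re = -⟪w, p⟫ := by
      rw [Quaternion.inner_def, Quaternion.star_eq_neg.2 hp_re, mul_neg, Quaternion.re_neg, neg_neg]
    rw [this, hwp, neg_zero, neg_zero, smul_zero]
  rw [hqp, map_add, hDq, hDp, mul_add, Quaternion.re_add, hconj, hq_re, zero_add, mul_smul_comm, Quaternion.re_smul, hrep, smul_zero]
end Lower

/-! ## §3 The tangent of the fibre map: closed form, tangency of the image, and the QUATERNION TANGENT FLOOR -/

section Fibre
variable {ι : Type*} [Fintype ι]

/-- **CLOSED FORM OF THE TANGENT MAP OF THE FIBRE MAP** at a unit `w` in the guard `‖aᵢw̄ − 1‖ < 1∕2`, along `w·x` (`x` imaginary):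
`k′(w)(w x) = D exp(Y)(N_Y x̃ − Σᵢ cᵢ N_{Zᵢ} x̃)·w`, `x̃ = w x w̄`, `Y = Y(w)`, `Zᵢ = qlog(aᵢw̄)` — pub-balaban's computation inside `kD_tangent_injective`
(key identity `D exp(Y)(N_Y x̃) = e^Y x̃` + part 26B's `YD_apply_mul`). [folklore] -/
theorem kD_apply_mul {a : ι → ℍ} (c : ι → ℝ) {w x : ℍ} (hw : ‖w‖ = 1) (ha : ∀ i, ‖a i‖ = 1) (hc : ∀ i, 0 ≤ c i) (hs : ∑ i, c i ≤ 1)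
    (hg : ∀ i, ‖a i * star w - 1‖ < 1 / 2) (hx : x.re = 0) :
    kD a c w (w * x) = fderiv ℝ exp (Yf a c w)
      (N (Yf a c w) (w * x * star w) - ∑ i, c i • N (qlog (a i * star w)) (w * x * star w)) * w := by
  have hsw : star w * w = 1 := by rw [Quaternion.star_mul_self, Quaternion.normSq_eq_norm_mul_self, hw]; simp
  have hXre : (w * x * star w).re = 0 := re_mul_mul_star w hx
  have hW1 : ∀ i, ‖a i * star w‖ = 1 := fun i => by simp [norm_mul, ha i, hw]
  have hZmem : ∀ i, qlog (a i * star w) ∈ imBall := fun i =>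
    ⟨qlog_re_of_norm_eq_one (hW1 i) ((hg i).trans (by norm_num)), (norm_qlog_lt_one (hg i)).trans (by linarith [Real.pi_gt_three])⟩
  have hYmem : Yf a c w ∈ imBall := sum_smul_mem_imBall (Z := fun i => qlog (a i * star w)) hZmem hc hs
  have hkey : fderiv ℝ exp (Yf a c w) (N (Yf a c w) (w * x * star w)) = exp (Yf a c w) * (w * x * star w) :=
    fderiv_exp_apply_N hYmem.1 hYmem.2 hXre
  rw [kD_apply, N08HaarCompatibilityGuardCoreInjective.YD_apply_mul c hw ha hg hx, map_neg, map_sub, hkey, neg_mul, sub_mul, ← sub_eq_add_neg]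
  congr 1
  rw [mul_assoc (exp (Yf a c w)) (w * x * star w) w, mul_assoc (w * x) (star w) w, hsw, mul_one]

/-- ★★ **THE QUATERNION TANGENT FLOOR, WITH THE TANGENT FORM OF THE IMAGE.**  At a unit `w` in the guard `‖aᵢw̄ − 1‖ < 1∕2` (unit `aᵢ`, `cᵢ ≥ 0`,
`Σcᵢ ≤ 1`), for every imaginary `x` there is an imaginary `y` with `k′(w)(w x) = k(w)·y` and
**`(1 − Σcᵢ)·sinc‖Y(w)‖·‖x‖ ≤ ‖y‖`** — pairing `N_Y x̃ − Σcᵢ N_{Zᵢ} x̃` with `x̃` gives `(1 − Σcᵢ)‖x̃‖² + [Σcᵢ G_{Zᵢ}(x̃) − G_Y(x̃)] ≥ (1 − Σcᵢ)‖x̃‖²`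
by pub-balaban's JENSEN step `G_sum_le`, then Cauchy–Schwarz and the lower singular value `sinc‖Y‖` of `D exp(Y)`; the image is tangent at `k(w)`
(`e^{−Y}·D exp(Y)(·)` is imaginary).  Part 14's bound in quaternion dress (pub-balaban's `kD_tangent_injective` made quantitative). [folklore] -/
theorem exists_kD_mul_eq {a : ι → ℍ} (c : ι → ℝ) {w x : ℍ} (hw : ‖w‖ = 1) (ha : ∀ i, ‖a i‖ = 1) (hc : ∀ i, 0 ≤ c i) (hs : ∑ i, c i ≤ 1)
    (hg : ∀ i, ‖a i * star w - 1‖ < 1 / 2) (hx : x.re = 0) :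
    ∃ y : ℍ, y.re = 0 ∧ kD a c w (w * x) = kf a c w * y ∧ (1 - ∑ i, c i) * Real.sinc ‖Yf a c w‖ * ‖x‖ ≤ ‖y‖ := by
  set Y := Yf a c w with hY_def
  set X := w * x * star w with hX_def
  set M : ℍ := N Y X - ∑ i, c i • N (qlog (a i * star w)) X with hM_def
  have hsw : star w * w = 1 := by rw [Quaternion.star_mul_self, Quaternion.normSq_eq_norm_mul_self, hw]; simp
  have hws : w * star w = 1 := by rw [Quaternion.self_mul_star, Quaternion.normSq_eq_norm_mul_self, hw]; simp
  have hXre : X.re = 0 := re_mul_mul_star w hx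
  have hXn : ‖X‖ = ‖x‖ := by rw [hX_def, norm_mul, norm_mul, Quaternion.norm_star, hw, one_mul, mul_one]
  have hW1 : ∀ i, ‖a i * star w‖ = 1 := fun i => by simp [norm_mul, ha i, hw]
  have hZmem : ∀ i, qlog (a i * star w) ∈ imBall := fun i =>
    ⟨qlog_re_of_norm_eq_one (hW1 i) ((hg i).trans (by norm_num)), (norm_qlog_lt_one (hg i)).trans (by linarith [Real.pi_gt_three])⟩
  have hYmem : Y ∈ imBall := sum_smul_mem_imBall (Z := fun i => qlog (a i * star w)) hZmem hc hs
  have hMre : M.re = 0 := by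
    have hsum : (∑ i, c i • N (qlog (a i * star w)) X).re = 0 :=
      Finset.sum_induction _ (fun q : ℍ => q.re = 0) (fun p q hp hq => by rw [Quaternion.re_add, hp, hq, add_zero]) (Quaternion.re_zero)
        (fun i _ => by rw [Quaternion.re_smul, N_re (hZmem i).1 hXre, smul_zero])
    rw [hM_def, Quaternion.re_sub, N_re hYmem.1 hXre, hsum, sub_zero]
  have hkD : kD a c w (w * x) = fderiv ℝ exp Y M * w := kD_apply_mul c hw ha hc hs hg hx
  refine ⟨star w * (exp (-Y) * fderiv ℝ exp Y M) * w, ?_, ?_, ?_⟩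
  · -- imaginary: conjugation by the unit `w` preserves real parts
    have h1 : (exp (-Y) * fderiv ℝ exp Y M).re = 0 := re_exp_neg_mul_fderiv_exp hYmem.1 hMre
    have h2 := re_mul_mul_star (star w) h1
    rwa [star_star] at h2
  · rw [hkD, kf, ← hY_def]
    simp only [← mul_assoc]
    rw [mul_assoc (exp Y) w (star w), hws, mul_one, exp_mul_exp_neg, one_mul]
  · -- the floor
    have hnorm : ‖star w * (exp (-Y) * fderiv ℝ exp Y M) * w‖ = ‖fderiv ℝ exp Y M‖ := by
      have hnY : (-Y).re = 0 := by rw [Quaternion.re_neg, hYmem.1, neg_zero]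
      rw [norm_mul, norm_mul, norm_mul, Quaternion.norm_star, hw, norm_exp_of_re_eq_zero hnY, one_mul, one_mul, mul_one]
    rw [hnorm]
    -- `(1 − s)‖X‖² ≤ ⟨M, X⟩ ≤ ‖M‖‖X‖`
    have hpair : (1 - ∑ i, c i) * ‖X‖ ^ 2 ≤ ⟪M, X⟫ := by
      have hJ : G Y X ≤ ∑ i, c i * G (qlog (a i * star w)) X := by
        rw [hY_def]; exact G_sum_le (Z := fun i => qlog (a i * star w)) hZmem hc hs X
      have hM : ⟪M, X⟫ = (‖X‖ ^ 2 - G Y X) - ∑ i, c i * (‖X‖ ^ 2 - G (qlog (a i * star w)) X) := by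
        rw [hM_def, inner_sub_left, sum_inner, inner_N_self_eq hYmem.1 hXre]
        congr 1
        exact Finset.sum_congr rfl fun i _ => by rw [real_inner_smul_left, inner_N_self_eq (hZmem i).1 hXre]
      have hsplit : ∑ i, c i * (‖X‖ ^ 2 - G (qlog (a i * star w)) X) = (∑ i, c i) * ‖X‖ ^ 2 - ∑ i, c i * G (qlog (a i * star w)) X := by
        rw [Finset.sum_mul, ← Finset.sum_sub_distrib]
        exact Finset.sum_congr rfl fun i _ => by ring
      rw [hM, hsplit]
      nlinarith
    have hMX : (1 - ∑ i, c i) * ‖X‖ ≤ ‖M‖ := by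
      rcases eq_or_ne X 0 with hX0 | hX0
      · rw [hX0, norm_zero, mul_zero]; exact norm_nonneg _
      have hXpos : 0 < ‖X‖ := norm_pos_iff.2 hX0
      have hcs : ⟪M, X⟫ ≤ ‖M‖ * ‖X‖ := real_inner_le_norm _ _
      nlinarith
    have hD : |Real.sinc ‖Y‖| * ‖M‖ ≤ ‖fderiv ℝ exp Y M‖ := abs_sinc_mul_norm_le_norm_fderiv_exp hYmem.1 hMre
    have hsinc : 0 ≤ Real.sinc ‖Y‖ := by
      rcases eq_or_ne ‖Y‖ 0 with h0 | h0
      · rw [h0, Real.sinc_zero]; norm_num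
      · rw [Real.sinc_of_ne_zero h0]
        exact div_nonneg (Real.sin_nonneg_of_nonneg_of_le_pi (norm_nonneg _) hYmem.2.le) (norm_nonneg _)
    rw [abs_of_nonneg hsinc] at hD
    rw [← hXn]
    calc (1 - ∑ i, c i) * Real.sinc ‖Y‖ * ‖X‖ = Real.sinc ‖Y‖ * ((1 - ∑ i, c i) * ‖X‖) := by ring
      _ ≤ Real.sinc ‖Y‖ * ‖M‖ := mul_le_mul_of_nonneg_left hMX hsinc
      _ ≤ ‖fderiv ℝ exp Y M‖ := hD
end Fibre

/-! ## §4 The volume lemma: a norm floor is a determinant floor -/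

section Volume
/-- ★ **NORM FLOOR ⇒ DETERMINANT FLOOR** [folklore]: a linear endomorphism `f` of `ℝⁿ` (Euclidean) with `κ‖x‖ ≤ ‖f x‖` for all `x` (`κ > 0`) has
`κⁿ ≤ |det f|` — `f` is onto, `f(B(0,1)) ⊇ B(0,κ)`, and Lebesgue measure scales by `|det f|` (Mathlib `addHaar_image_continuousLinearMap`,
`addHaar_ball_of_pos`). -/
theorem pow_le_abs_det_of_norm_le {n : Type*} [Fintype n] (f : EuclideanSpace ℝ n →L[ℝ] EuclideanSpace ℝ n) {κ : ℝ} (hκ : 0 < κ)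
    (hf : ∀ x, κ * ‖x‖ ≤ ‖f x‖) : κ ^ Fintype.card n ≤ |LinearMap.det (f : EuclideanSpace ℝ n →ₗ[ℝ] EuclideanSpace ℝ n)| := by
  have hinj : Function.Injective f := by
    intro x y hxy
    have h := hf (x - y)
    rw [map_sub, hxy, sub_self, norm_zero] at h
    have : ‖x - y‖ ≤ 0 := by nlinarith [norm_nonneg (x - y)]
    exact sub_eq_zero.1 (norm_le_zero_iff.1 this)
  have hsurj : Function.Surjective (f : EuclideanSpace ℝ n →ₗ[ℝ] EuclideanSpace ℝ n) :=
    LinearMap.surjective_of_injective hinj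
  have hball : ball (0 : EuclideanSpace ℝ n) κ ⊆ f '' ball (0 : EuclideanSpace ℝ n) 1 := by
    intro y hy
    obtain ⟨x, rfl⟩ := hsurj y
    refine ⟨x, ?_, rfl⟩
    rw [mem_ball_zero_iff] at hy ⊢
    have := hf x
    have h' : κ * ‖x‖ < κ * 1 := by rw [mul_one]; exact lt_of_le_of_lt this hy
    exact lt_of_mul_lt_mul_left h' hκ.le
  have hvol := measure_mono (μ := (volume : Measure (EuclideanSpace ℝ n))) hball
  rw [Measure.addHaar_image_continuousLinearMap, Measure.addHaar_ball_of_pos _ _ hκ, finrank_euclideanSpace] at hvol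
  have h0 : (volume : Measure (EuclideanSpace ℝ n)) (ball 0 1) ≠ 0 := (measure_ball_pos _ _ zero_lt_one).ne'
  have htop : (volume : Measure (EuclideanSpace ℝ n)) (ball 0 1) ≠ ⊤ := measure_ball_lt_top.ne
  have h := (ENNReal.mul_le_mul_iff_left h0 htop).1 hvol
  exact (ENNReal.ofReal_le_ofReal_iff (abs_nonneg _)).1 h
end Volume
end Summit.QuantumFields.YangMills.BalabanUVNodes.N08HaarCompatibilityGuardChartLift

end
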